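import Summits.BirchSwinnertonDyer.Rank1Residual.Supersingular.BlindInterpolationFlatTwo
import Summits.BirchSwinnertonDyer.Rank1Residual.Supersingular.SprungConstantTerm
import Summits.BirchSwinnertonDyer.Rank1Residual.Supersingular.SignedRankZero
import Literature.NumberTheory.EllipticCurves.SkinnerUrban2014.PAdicUnitPeriodRatioAnyPrimeProofs
import HarnessLib

/-!
# The (α♭) door at `p = 2`, REPAIRED: (P) and `2 ∤ c` DERIVED from `L♭(0) = (−a₂²+2a₂+1)·[0]⁺_f`
# and the `2`-adic period unit (Abbes–Ullmo Thm. A), via UNIT RENORMALISATION of the signed datum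
# (cell `b2b-bsdres`, O1 sub-cell `p = 2`; cc-typer-4 GEN 10, typer item (32) of o1 lead ruling
# R-G33.2 / D46 = T-c repair of p297620 after o1 refuter GEN 18, `REFUTER-O1.md` v18 §134)

HONEST FRAMING (run/shared/lean/b2b/bsd-rank1-residual/, verbatim in every file): the goal of the
cell is to DELETE the COMBINATION-SHAPED residual classes of the Birch–Swinnerton-Dyer formula for
ALL analytic-rank `≤ 1` elliptic curves over `ℚ` — "full BSD formula for every rank `≤ 1` curve in
class `C`" assembled STRICTLY from published theorems — so that the rank-`≤ 1` remainder becomes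
exactly the CONSTRUCTION-SHAPED classes, which are TYPED (missing-input `Prop`s), NOT attempted.
This is not "finishing BSD". THEOREMS ONLY about the tree's typed objects (`SignedDatum`,
`IsSprungPair`, `mazurTateElement`, `ratPlusSymbol`, `BlindLever.evalAt`); every hypothesis
explicit; nothing about any particular curve, Selmer group or `L`-function is asserted; nothing
booked; no label moves.

WHY. The door of record p297620 `BlindLever.bsdp_two_of_oneDivisibility_of_blindControl_flat` binds
the UN-normalised `♭`-function `D.L` of a datum `D = (ξ, L, c)` to BOTH `hSP : IsSprungPair f 2 a₂ Ls
D.L` (level-`0` clause: `D.L(0) = −θ_0(0)`) AND (P) `hP : D.Interpolation` (`D.L(0) = c·L(E,1)/Ω_E`,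
`c : ℕ`). At `p = 2`, `θ_0` lives at level `2^{0+e₀} = 4`, `θ_0(0) = ∑_{(ℤ/4)ˣ}[a/4]⁺_f = (a₂² − 2a₂ −
1)·[0]⁺_f`: **`L♭(0) = (−a₂²+2a₂+1)·[0]⁺_f`** (`−7·[0]⁺_f` at `a₂ = −2`; NOT the `p`-odd `chromaticConst
p a .flat = 2 − a`). With `L(E,1) = [0]⁺_f·Ω⁺_f ≠ 0`, `Ω⁺_f, Ω_E > 0`, `c ≥ 0`, p297620's binders `{hf,
hgood, ha = −2, hL, hSP, hP}` are jointly unsatisfiable (o1 refuter GEN 18, kernel-verified; o1 lead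
D46 CONCUR: misstated-TYPE, a normalisation slip of the typing; p290263 is correct; p297620 unedited).

WHAT (repair C″ by UNIT RENORMALISATION; composition only; ONE definition; no named fact):
* §1 (o1 refuter GEN 18) the `♭` constant term at `2` (i), (ii); the REPAIRED reading **(P′)** (v)
  `D.L(0) = v·L(E,1)/Ω_E`, `v = (−a₂²+2a₂+1)·u ∈ ℚ` a `2`-adic UNIT when `Ω_E = u·Ω⁺_f`, `‖u‖₂ = 1`;
  (vi) `u` from the tree's A-PER2 `SkinnerUrban2014.realPeriodRat_eq_unit_mul_plusPeriod_two_of_abbesUllmo`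
  and the named fact `hAU : abbesUllmo_not_dvd_maninConstant_of_not_dvd_level`, `E[2]` irreducible;
* §2 (`p` generic) `SignedDatum.unitRescale D w := ⟨ξ, C(w)·L, 1⟩`, `w ∈ ℤ_pˣ` (the tree's odd-`p`
  pattern `exists_units_interpolation_chromaticL`), with (K) (`Iff.rfl`), (MC↓)/(MC↑) (`C(w) ∈ Λˣ`)
  and **(P′) ⇒ (P) EXACTLY with `c = 1`** (`w = v⁻¹`) across it; §3 the blind inputs (K₋₂), (P₋₂);
* §5 **THE REPAIRED DOOR** `BlindLever.bsdp_two_of_oneDivisibility_of_blindControl_flat_of_abbesUllmo`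
  = p297620's binders MINUS `hP`, `hc` PLUS `hAU`, conclusion `BSDp W 2`, proof = the UNMODIFIED
  p290263 `bsdp_two_of_oneDivisibility_of_blindControl` on `D.unitRescale v⁻¹`. Inputs after repair:
  OPEN `hK`, `hdiv`, `hKb`, `hCb` (+ GZK); DERIVED (P), `2 ∤ c`, (P₋₂); PUB `hAU`, `hirr`, `hgood`,
  `hf`. Positive control `exists_interpolation_unitRescale_flat_two`;
* §§4–5 DIAGNOSTICS on p297620 AS TYPED (nothing withdrawn): (iii)
  `not_interpolation_of_isSprungPair_two_of_frobeniusTrace_eq_neg_two`, (A)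
  `blindFlatDoor_bsdp_and_false_of_frobeniusTrace_eq_neg_two` (p297620's full binder telescope at
  `a₂ = −2` ⊢ `BSDp W 2 ∧ False`); at `a₂ = +2`, (P) as typed pins `c·Ω⁺_f = Ω_E` (refuter (iv)).

CREDIT. §1, §4: o1 refuter GEN 18 `HOME/b2b-bsdres-o1-refuter/g18/lean/W18-FlatDoorVacuity.lean`
(sha256 `3148b5f59c2ad534…`); §§2–3, §5: o1 lead GEN 33 (sha256 `066ee862009f04a0…`)
`HOME/b2b-bsdres-o1-lead/D46_FlatDoorVacuity_secondcheck_g33.lean` + `D46-flat-door-vacuity-…-g33.md`;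
ported VERBATIM up to the namespace (`RefuterG18` / `LeadG33` ↦ `Supersingular` / `SignedDatum` / `BlindLever`).
References (shape only; nothing asserted): [Sprung2017] Thm. 1.12, Cor. 4.4, Cor. 4.11;
[AbbesUllmo1996] Thm. A; [GreenbergVatsal2000] §3 Rem. 3.4; [RaySprung2025] §1.2 (p. 2343);
[Kobayashi2003] §3, Thm. 1.2; [Miller2011LMS] Def. 1.1. Folder record: `HOME/cells/o1/PLAN.md` §39
C230–C234; `HOME/cells/o1/ROUTES-O1.md` register v4.0.
-/

set_option autoImplicit false

noncomputable section

open scoped Classical MatrixGroups ModularForm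

open PowerSeries Polynomial CongruenceSubgroup WeierstrassCurve Literature.NumberTheory.EllipticCurves
  Literature.NumberTheory.EllipticCurves.ModularForms Literature.NumberTheory.EllipticCurves.Sprung2017

namespace Summit.BirchSwinnertonDyer.Rank1Residual.Supersingular

/-! ## §1. The `♭` constant term at `p = 2` and the repaired reading (P′) (o1 refuter GEN 18) -/

section ConstantTerm

variable {N : ℕ} [NeZero N] {f : CuspForm (Gamma0 N) 2}

/-- At `p = 2` the level of `θ_0` is `2^{0 + e₀}`, `0 + e₀ = 1 + 1` (cf. `zero_add_cyclotomicExponent_eq`).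
[folklore] -/
theorem zero_add_cyclotomicExponent_two : 0 + cyclotomicExponent 2 = 1 + 1 := by
  unfold cyclotomicExponent; rw [if_pos rfl]

/-- (i) **`L♭(0) = (−a₂² + 2a₂ + 1)·[0]⁺_f` at `p = 2`**, for ANY pair satisfying the level-`0`
Mazur–Tate clause `θ_0 ≡ −(u_0 L♯ + v_0 L♭) = −L♭ (mod ω_0 = T)` at an odd level `N` for a rational
newform `f` with `a_2(f) = ap`: `θ_0(0) = ∑_{a ∈ (ℤ/4)ˣ}[a/4]⁺_f = (a₂² − 2a₂ − 2 + 1)·[0]⁺_f` (the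
level-`p²` unit sum at `p = 2`; the `p`-odd sibling `constantCoeff_flat_of_isCongrModOmega_zero` has
`(2 − a_p)·[0]⁺_f` — at `2` the index shift `e₀ = 2`). [cite: Sprung2017, Cor. 4.4 and Cor. 4.11] -/
theorem constantCoeff_flat_two_of_isCongrModOmega_zero (hf : IsNewform0 f)
    (hQ : coeffField f = ⊥) (hN : ¬ 2 ∣ N) {ap : ℤ} (hap : cuspCoeff f 2 = ap)
    {Lsharp Lflat : IwasawaAlgebra 2}
    (h0 : IsCongrModOmega 2 0 (mazurTateElement f 2 0) (-1)
      (toIwasawa 2 (sharpPoly ap 2 0) * Lsharp + toIwasawa 2 (flatPoly ap 2 0) * Lflat)) :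
    ((PowerSeries.constantCoeff Lflat : ℤ_[2]) : ℚ_[2]) =
      (((-(ap : ℚ) ^ 2 + 2 * ap + 1) * ratPlusSymbol f 0 : ℚ) : ℚ_[2]) := by
  have h := algebraMap_eval_zero_eq_of_isCongrModOmega h0
  rw [mazurTateElement_eval_zero,
    sum_units_ratPlusSymbol_level_two_eq hf hQ hN hap _ zero_add_cyclotomicExponent_two,
    map_add, constantCoeff_toIwasawa_mul, constantCoeff_toIwasawa_mul, sharpPoly_zero,
    flatPoly_zero] at h
  simp only [eval_neg, eval_one, eval_zero, Int.cast_zero, zero_mul, zero_add, Int.cast_one,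
    one_mul, Int.cast_neg] at h
  rw [eq_ratCast] at h
  push_cast at h ⊢
  linear_combination h

variable {W : WeierstrassCurve ℚ} [W.IsElliptic] [W.IsGloballyMinimal]

/-- (ii) **`D.L(0) = (−a₂(E)² + 2a₂(E) + 1)·[0]⁺_f`** for ANY Sprung pair `(Ls, Lf)` at `2` of the
newform `f` of `E = W` with good reduction at `2`. [cite: Sprung2017, Thm. 1.12 and Cor. 4.4] -/
theorem constantCoeff_flat_two_of_isSprungPair_of_isNewformOf (hf : IsNewformOf W f)
    (hgood : W.HasGoodReductionAtPrime 2) {Ls Lf : IwasawaAlgebra 2}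
    (hSP : IsSprungPair f 2 (W.frobeniusTrace 2) Ls Lf) :
    ((PowerSeries.constantCoeff Lf : ℤ_[2]) : ℚ_[2]) =
      (((-(W.frobeniusTrace 2 : ℚ) ^ 2 + 2 * (W.frobeniusTrace 2) + 1) * ratPlusSymbol f 0 : ℚ) :
        ℚ_[2]) :=
  constantCoeff_flat_two_of_isCongrModOmega_zero hf.1 hf.coeffField_eq_bot
    (not_dvd_level_of_isNewformOf hf hgood) (cuspCoeff_eq_frobeniusTrace_of_isNewformOf_holds hf hgood)
    (hSP 0)

/-- (v) **(P′) at `p = 2`, DERIVED for either sign.** For `f` the newform of `E = W` (good at `2`,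
`a₂ = ±2`), ANY Sprung pair `(Ls, D.L)` at `2` and a `2`-adic-unit period ratio `Ω_E = u·Ω⁺_f`:
`D.L(0) = v · L(E,1)/Ω_E` with `v = (−a₂² + 2a₂ + 1)·u ∈ ℚ` a `2`-adic unit (`u` / `−7u` at
`a₂ = 2` / `−2`) — NO sign or integrality demand on the constant. [cite: Sprung2017, Thm. 1.12, Cor. 4.4] -/
theorem interpolationUnit_flat_two (hf : IsNewformOf W f) (hgood : W.HasGoodReductionAtPrime 2)
    (ha : W.frobeniusTrace 2 = 2 ∨ W.frobeniusTrace 2 = -2) (D : SignedDatum W 2)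
    {Ls : IwasawaAlgebra 2} (hSP : IsSprungPair f 2 (W.frobeniusTrace 2) Ls D.L)
    (hu : ∃ u : ℚ, ‖(u : ℚ_[2])‖ = 1 ∧ W.realPeriodRat = u * plusPeriod f) :
    ∃ t : ℚ, W.entireLFunction 1 / (W.realPeriodRat : ℂ) = (t : ℂ) ∧
      ∃ v : ℚ, ‖(v : ℚ_[2])‖ = 1 ∧
        ((PowerSeries.constantCoeff D.L : ℤ_[2]) : ℚ_[2]) = (v : ℚ_[2]) * ((t : ℚ) : ℚ_[2]) := by
  obtain ⟨u, hu1, hΩ⟩ := hu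
  have hΩpos : 0 < W.realPeriodRat := W.realPeriodRat_pos_holds
  have hu0 : u ≠ 0 := by rintro rfl; simp at hu1
  have huC : ((u : ℚ) : ℂ) ≠ 0 := by exact_mod_cast hu0
  have hk : (-(W.frobeniusTrace 2) ^ 2 + 2 * W.frobeniusTrace 2 + 1 : ℤ) = 1 ∨
      (-(W.frobeniusTrace 2) ^ 2 + 2 * W.frobeniusTrace 2 + 1 : ℤ) = -7 := by
    rcases ha with h | h <;> rw [h] <;> norm_num
  set k : ℤ := -(W.frobeniusTrace 2) ^ 2 + 2 * W.frobeniusTrace 2 + 1 with hk_def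
  have hkdvd : ¬ (2 : ℤ) ∣ k := by rcases hk with h | h <;> rw [h] <;> decide
  have hk1 : ‖((k : ℤ) : ℚ_[2])‖ = 1 :=
    le_antisymm (Padic.norm_int_le_one k) (not_lt.mp (mt Padic.norm_intCast_lt_one_iff.mp hkdvd))
  refine ⟨ratPlusSymbol f 0 / u, ?_, (k : ℚ) * u, ?_, ?_⟩
  · rw [hf.entireLFunction_one_eq, div_eq_iff (Complex.ofReal_ne_zero.mpr hΩpos.ne'), hΩ]
    push_cast; rw [div_mul_eq_mul_div, eq_div_iff huC]; ring
  · rw [show ((((k : ℚ) * u : ℚ)) : ℚ_[2]) = ((k : ℤ) : ℚ_[2]) * ((u : ℚ) : ℚ_[2]) by push_cast; ring,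
      norm_mul, hk1, hu1, mul_one]
  · rw [constantCoeff_flat_two_of_isSprungPair_of_isNewformOf hf hgood hSP, ← Rat.cast_mul]
    congr 1
    rw [hk_def, mul_assoc, mul_div_cancel₀ _ hu0]; push_cast; ring

/-- (vi) **(P′) at `p = 2` from binders the door ALREADY displays plus ONE named fact `hAU`**: (v)
with `u` from the tree's A-PER2 `SkinnerUrban2014.realPeriodRat_eq_unit_mul_plusPeriod_two_of_abbesUllmo`
(Abbes–Ullmo Thm. A; `E[2]` irreducible). [cite: AbbesUllmo1996, Thm. A] [cite: GreenbergVatsal2000, §3] -/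
theorem interpolationUnit_flat_two_of_abbesUllmo
    (hAU : abbesUllmo_not_dvd_maninConstant_of_not_dvd_level)
    (hf : IsNewformOf W f) (hgood : W.HasGoodReductionAtPrime 2)
    (hirr : W.HasIrreducibleModPGaloisRep 2)
    (ha : W.frobeniusTrace 2 = 2 ∨ W.frobeniusTrace 2 = -2) (D : SignedDatum W 2)
    {Ls : IwasawaAlgebra 2} (hSP : IsSprungPair f 2 (W.frobeniusTrace 2) Ls D.L) :
    ∃ t : ℚ, W.entireLFunction 1 / (W.realPeriodRat : ℂ) = (t : ℂ) ∧
      ∃ v : ℚ, ‖(v : ℚ_[2])‖ = 1 ∧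
        ((PowerSeries.constantCoeff D.L : ℤ_[2]) : ℚ_[2]) = (v : ℚ_[2]) * ((t : ℚ) : ℚ_[2]) :=
  interpolationUnit_flat_two hf hgood ha D hSP
    (SkinnerUrban2014.realPeriodRat_eq_unit_mul_plusPeriod_two_of_abbesUllmo hAU W hgood hirr f hf)

end ConstantTerm

/-! ## §2. Unit renormalisation of a signed datum (`p` generic): `(ξ, L, c) ↦ (ξ, w·L, 1)` -/

/-- `C(w)` is a unit of `Λ = ℤ_p⟦T⟧` for `w ∈ ℤ_pˣ`. [folklore] -/
theorem isUnit_C_units {p : ℕ} [Fact p.Prime] (w : ℤ_[p]ˣ) :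
    IsUnit (PowerSeries.C (w : ℤ_[p]) : PowerSeries ℤ_[p]) := (Units.isUnit w).map _

/-- Inverse units of `ℤ_p` multiply to `1` in `ℚ_p`. [folklore] -/
theorem coe_units_inv_mul {p : ℕ} [Fact p.Prime] (w : ℤ_[p]ˣ) :
    (((w⁻¹ : ℤ_[p]ˣ) : ℤ_[p]) : ℚ_[p]) * ((w : ℤ_[p]) : ℚ_[p]) = 1 := by
  rw [← PadicInt.coe_mul, Units.inv_mul, PadicInt.coe_one]

namespace SignedDatum

variable {W : WeierstrassCurve ℚ} {p : ℕ} [Fact p.Prime]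

/-- **Unit renormalisation of a signed datum**: `(ξ, L, c) ↦ (ξ, w·L, 1)`, `w ∈ ℤ_pˣ` — the odd-`p`
pattern `exists_units_interpolation_chromaticL` for any `p` (o1 lead D46 §3; a definition). [folklore] -/
def unitRescale (D : SignedDatum W p) (w : ℤ_[p]ˣ) : SignedDatum W p :=
  ⟨D.xi, PowerSeries.C (w : ℤ_[p]) * D.L, 1⟩

/-- The renormalisation keeps `ξ`. [folklore] -/
@[simp] theorem unitRescale_xi (D : SignedDatum W p) (w : ℤ_[p]ˣ) : (D.unitRescale w).xi = D.xi :=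
  rfl

/-- The renormalisation multiplies `L` by the constant unit `C(w)`. [folklore] -/
@[simp] theorem unitRescale_L (D : SignedDatum W p) (w : ℤ_[p]ˣ) :
    (D.unitRescale w).L = PowerSeries.C (w : ℤ_[p]) * D.L := rfl

/-- The renormalised interpolation constant is `1`. [folklore] -/
@[simp] theorem unitRescale_c (D : SignedDatum W p) (w : ℤ_[p]ˣ) : (D.unitRescale w).c = 1 := rfl

/-- The renormalised constant `1` is prime to `p`. [folklore] -/
theorem not_dvd_unitRescale_c (D : SignedDatum W p) (w : ℤ_[p]ˣ) : ¬ p ∣ (D.unitRescale w).c :=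
  (Fact.out : p.Prime).not_dvd_one

/-- (K) is a statement about `ξ` only: unchanged. [folklore] -/
theorem eulerCharacteristic_unitRescale_iff (D : SignedDatum W p) (w : ℤ_[p]ˣ) :
    (D.unitRescale w).EulerCharacteristic ↔ D.EulerCharacteristic := Iff.rfl

/-- (MC↓) `w·L ∣ ξ ↔ L ∣ ξ` (`C(w) ∈ Λˣ`). [folklore] -/
theorem lowerDivisibility_unitRescale_iff (D : SignedDatum W p) (w : ℤ_[p]ˣ) :
    (D.unitRescale w).LowerDivisibility ↔ D.LowerDivisibility :=
  IsUnit.mul_left_dvd (isUnit_C_units w)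

/-- (MC↑) `ξ ∣ w·L ↔ ξ ∣ L` (`C(w) ∈ Λˣ`). [folklore] -/
theorem upperDivisibility_unitRescale_iff (D : SignedDatum W p) (w : ℤ_[p]ˣ) :
    (D.unitRescale w).UpperDivisibility ↔ D.UpperDivisibility :=
  IsUnit.dvd_mul_left (isUnit_C_units w)

/-- **(P′) ⇒ (P) for the renormalised datum** (o1 lead D46 §3): if `D.L(0) = v · t`, `t = L(E,1)/Ω_E
∈ ℚ`, `v ∈ ℚ` a `p`-adic unit, then `(ξ, v⁻¹·L, 1)` satisfies (P) EXACTLY with `c = 1`. [folklore] -/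
theorem interpolation_unitRescale_of_unit (D : SignedDatum W p) {v t : ℚ}
    (hv : ‖((v : ℚ) : ℚ_[p])‖ = 1)
    (ht : W.entireLFunction 1 / (W.realPeriodRat : ℂ) = (t : ℂ))
    (hLt : ((PowerSeries.constantCoeff D.L : ℤ_[p]) : ℚ_[p]) = ((v : ℚ) : ℚ_[p]) * ((t : ℚ) : ℚ_[p])) :
    (D.unitRescale (PadicInt.mkUnits hv)⁻¹).Interpolation := by
  refine ⟨t, ht, ?_⟩
  have hw : ((((PadicInt.mkUnits hv)⁻¹ : ℤ_[p]ˣ) : ℤ_[p]) : ℚ_[p]) * ((v : ℚ) : ℚ_[p]) = 1 := by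
    have h1 := coe_units_inv_mul (p := p) (PadicInt.mkUnits hv)
    rwa [PadicInt.mkUnits_eq] at h1
  rw [unitRescale_L, unitRescale_c, map_mul, PowerSeries.constantCoeff_C, PadicInt.coe_mul, hLt,
    Nat.cast_one, one_mul, ← mul_assoc, hw, one_mul]

end SignedDatum

namespace BlindLever

section Package

variable {W : WeierstrassCurve ℚ}

/-! ## §3. The blind (`p = 2`) inputs across the renormalisation -/

/-- (K₋₂) is a statement about `ξ` only: unchanged. [folklore] -/
theorem blindEulerCharacteristicAt_unitRescale_iff (D : SignedDatum W 2) (w : ℤ_[2]ˣ)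
    (Wd : WeierstrassCurve ℚ) (e : ℕ) :
    (D.unitRescale w).BlindEulerCharacteristicAt Wd e ↔ D.BlindEulerCharacteristicAt Wd e := Iff.rfl

/-- (P₋₂) `L(−2) = u′·2^e·S` is invariant under `L ↦ w·L` (`u′ ↦ w·u′`; values multiply on the
open disc, `evalAt_mul`, `evalAt_C`) (o1 lead D46 §4). [folklore] -/
theorem blindInterpolation_unitRescale_iff (D : SignedDatum W 2) (w : ℤ_[2]ˣ) (S : ℚ) (e : ℕ) :
    (D.unitRescale w).BlindInterpolation S e ↔ D.BlindInterpolation S e := by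
  have hev : BlindLever.evalAt (-2 : ℤ_[2]) (D.unitRescale w).L =
      (w : ℤ_[2]) * BlindLever.evalAt (-2 : ℤ_[2]) D.L := by
    rw [D.unitRescale_L, BlindLever.evalAt_mul BlindLever.norm_neg_two_lt_one, BlindLever.evalAt_C]
  have hwinv := coe_units_inv_mul (p := 2) w
  unfold SignedDatum.BlindInterpolation
  rw [hev, PadicInt.coe_mul]
  constructor
  · rintro ⟨u, hu⟩
    refine ⟨w⁻¹ * u, ?_⟩
    rw [Units.val_mul, PadicInt.coe_mul]
    linear_combination (((w⁻¹ : ℤ_[2]ˣ) : ℤ_[2]) : ℚ_[2]) * hu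
      - ((BlindLever.evalAt (-2 : ℤ_[2]) D.L : ℤ_[2]) : ℚ_[2]) * hwinv
  · rintro ⟨u, hu⟩
    refine ⟨w * u, ?_⟩
    rw [Units.val_mul, PadicInt.coe_mul, hu]
    ring

/-! ## §4. Diagnostic on p297620 AS TYPED, I: (P) with `c : ℕ` contradicts `hSP` at `a₂ = −2` -/

section Form

variable [W.IsElliptic] [W.IsGloballyMinimal] {N : ℕ} [NeZero N] {f : CuspForm (Gamma0 N) 2}

/-- (iii) **(P) contradicts `hSP` at `a₂ = −2`** (o1 refuter GEN 18 §134; o1 lead D46 CONCUR). For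
`f` the newform of `E = W` (good at `2`, `a₂(E) = −2`, `L(E,1) ≠ 0`) and a datum `D` whose `L` is the
`♭` member of a Sprung pair at `2`, `D.Interpolation` (`D.L(0) = c·L(E,1)/Ω_E`, `c : ℕ`) is FALSE:
`D.L(0) = −7·[0]⁺_f` while `c·[0]⁺_f·Ω⁺_f/Ω_E` has the sign of `[0]⁺_f ≠ 0` (or is `0`). So p297620's
`a₂ = −2` half is vacuous AS TYPED (nothing withdrawn; repaired door in §5). [folklore] -/
theorem not_interpolation_of_isSprungPair_two_of_frobeniusTrace_eq_neg_two (hf : IsNewformOf W f)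
    (hgood : W.HasGoodReductionAtPrime 2) (ha : W.frobeniusTrace 2 = -2)
    (hL : W.entireLFunction 1 ≠ 0) (D : SignedDatum W 2) {Ls : IwasawaAlgebra 2}
    (hSP : IsSprungPair f 2 (W.frobeniusTrace 2) Ls D.L) : ¬ D.Interpolation := by
  rintro ⟨t, ht, hP⟩
  have hΩpos : 0 < W.realPeriodRat := W.realPeriodRat_pos_holds
  have hΩf : 0 < plusPeriod f := IsNewform0.plusPeriod_pos_holds hf.1 hf.coeffField_eq_bot
  set s : ℚ := ratPlusSymbol f 0 with hs_def
  have hLval : W.entireLFunction 1 = (((s : ℝ) * plusPeriod f : ℝ) : ℂ) := hf.entireLFunction_one_eq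
  have hs0 : s ≠ 0 := by intro h0; apply hL; rw [hLval, h0]; simp
  -- the archimedean relation `s · Ω⁺_f = t · Ω_E`; the `2`-adic relation `c · t = −7 · s` read in `ℚ`
  have hreal : (s : ℝ) * plusPeriod f = (t : ℝ) * W.realPeriodRat := by
    have h := ht
    rw [hLval, div_eq_iff (Complex.ofReal_ne_zero.mpr hΩpos.ne')] at h
    exact_mod_cast h
  have hLc : ((PowerSeries.constantCoeff D.L : ℤ_[2]) : ℚ_[2]) = (((-7) * s : ℚ) : ℚ_[2]) := by
    rw [constantCoeff_flat_two_of_isSprungPair_of_isNewformOf hf hgood hSP, ha]; push_cast; ring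
  have hQ : (D.c : ℚ) * t = -7 * s := by have h := hP; rw [hLc] at h; exact_mod_cast h.symm
  have hR : (D.c : ℝ) * (t : ℝ) = -7 * (s : ℝ) := by exact_mod_cast hQ
  -- combine: `s · (c · Ω⁺_f + 7 · Ω_E) = 0` with the bracket positive and `s ≠ 0`
  have key : (s : ℝ) * ((D.c : ℝ) * plusPeriod f + 7 * W.realPeriodRat) = 0 := by
    have e1 : (D.c : ℝ) * ((t : ℝ) * W.realPeriodRat) = (D.c : ℝ) * ((s : ℝ) * plusPeriod f) := by
      rw [hreal]
    linear_combination (-1 : ℝ) * e1 + W.realPeriodRat * hR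
  have hpos : 0 < (D.c : ℝ) * plusPeriod f + 7 * W.realPeriodRat :=
    add_pos_of_nonneg_of_pos (mul_nonneg (Nat.cast_nonneg _) hΩf.le) (by linarith)
  rcases mul_eq_zero.mp key with h | h
  · exact hs0 (by exact_mod_cast h)
  · exact hpos.ne' h

end Form

/-! ## §5. The REPAIRED (α♭) door (ruling R-G33.2), its positive control, and diagnostic II -/

section Curve

variable [W.IsElliptic] [W.IsGloballyMinimal] [NeZero (W.conductorNorm ℤ)]
  {f : CuspForm (Gamma0 (W.conductorNorm ℤ)) 2}

open Literature.NumberTheory.EllipticCurves.Rank1Residual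
  Literature.NumberTheory.EllipticCurves.Rank1Residual.Typed

/-- **R-L1-G10-B (α♭) ASSEMBLY, REPAIRED (`p = 2`, analytic rank `0`, `♭`, `a₂ = ±2`,
`w_E·χ₈(N_E) = +1`).** The door p297620 `bsdp_two_of_oneDivisibility_of_blindControl_flat` with its
trivial-character inputs `hP : D.Interpolation`, `hc : 2 ∤ D.c` SHED — they are DERIVED: `D.L(0) =
v·L(E,1)/Ω_E` with `v = (−a₂² + 2a₂ + 1)·(Ω_E/Ω⁺_f) ∈ ℚ` a `2`-adic unit (§1; A-PER2 from Abbes–Ullmo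
Thm. A = the ONE added named fact `hAU`, `E[2]` irreducible) — and the UNMODIFIED rank-`0` chain
p290263 `bsdp_two_of_oneDivisibility_of_blindControl` applied to the unit-renormalised datum
`D.unitRescale v⁻¹ = (ξ, v⁻¹·L♭, 1)`, across which (K), (MC↓)/(MC↑), (K₋₂), (P₋₂) transfer and on
which (P) holds EXACTLY with `c = 1`. Inputs: OPEN / FRONTIER — (K) `hK`, ONE signed divisibility
`hdiv`, (K₋₂) `hKb` at index `2` for a `ℚ`-model `Wd` of `E^{(2)}`, (C₋₂) `hCb` at `S = [1/8]⁺_f −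
[5/8]⁺_f`, GZK; PUBLISHED — `hAU`, `hirr`, `hgood`, `hf`; per curve — `hL`, `ha`, `hsign`, `htw`.
Composition only; nothing asserted; no count, price or mark moves by it. [cite: AbbesUllmo1996, Thm. A]
[cite: Sprung2017, Thm. 1.12 and Cor. 4.4] [cite: RaySprung2025, §1.2 (p. 2343)]
[cite: Kobayashi2003, §3 and Thm. 1.2] [cite: Miller2011LMS, Def. 1.1] -/
theorem bsdp_two_of_oneDivisibility_of_blindControl_flat_of_abbesUllmo
    (hAU : abbesUllmo_not_dvd_maninConstant_of_not_dvd_level)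
    (hGZK : rank_eq_analyticRank_of_analyticRank_le_one)
    (hirr : W.HasIrreducibleModPGaloisRep 2) (hL : W.entireLFunction 1 ≠ 0) (D : SignedDatum W 2)
    (hK : D.EulerCharacteristic) (hdiv : D.LowerDivisibility ∨ D.UpperDivisibility)
    (hf : IsNewformOf W f) (hgood : W.HasGoodReductionAtPrime 2)
    (ha : W.frobeniusTrace 2 = 2 ∨ W.frobeniusTrace 2 = -2)
    (hsign : W.rootNumber * ZMod.χ₈ (W.conductorNorm ℤ : ZMod 8) = 1) {Ls : IwasawaAlgebra 2}
    (hSP : IsSprungPair f 2 (W.frobeniusTrace 2) Ls D.L)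
    {Wd : WeierstrassCurve ℚ} (htw : ∃ C : VariableChange ℚ, C • W.quadraticTwist 2 = Wd)
    (hKb : D.BlindEulerCharacteristicAt Wd 2)
    (hCb : BlindDescentCertificate Wd
      (ratPlusSymbol f ((1 : ℚ) / 8) - ratPlusSymbol f ((5 : ℚ) / 8))) : BSDp W 2 := by
  obtain ⟨t, ht, v, hv, hLt⟩ := interpolationUnit_flat_two_of_abbesUllmo hAU hf hgood hirr ha D hSP
  have hPb := blindInterpolation_flat_of_isNewformOf D hf hgood ha hsign hSP
  have hdiv' : (D.unitRescale (PadicInt.mkUnits hv)⁻¹).LowerDivisibility ∨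
      (D.unitRescale (PadicInt.mkUnits hv)⁻¹).UpperDivisibility :=
    hdiv.imp (D.lowerDivisibility_unitRescale_iff _).mpr (D.upperDivisibility_unitRescale_iff _).mpr
  exact bsdp_two_of_oneDivisibility_of_blindControl W hGZK hirr hL
    (D.unitRescale (PadicInt.mkUnits hv)⁻¹) (D.not_dvd_unitRescale_c _)
    ((D.eulerCharacteristic_unitRescale_iff _).mpr hK)
    (D.interpolation_unitRescale_of_unit hv ht hLt) hdiv' htw
    ((blindEulerCharacteristicAt_unitRescale_iff D _ Wd 2).mpr hKb)
    ((blindInterpolation_unitRescale_iff D _ _ 2).mpr hPb) hCb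

/-- (A′) **Positive control: the repaired door has NO `a₂ = −2` obstruction of the §134 kind** — for
every Sprung pair at `a₂ = ±2` SOME unit renormalisation of the datum satisfies (P) with `c = 1` (the
unit at `a₂ = −2` is `v = −7·(Ω_E/Ω⁺_f)`; o1 lead D46 §5). [cite: Sprung2017, Thm. 1.12 and Cor. 4.4] -/
theorem exists_interpolation_unitRescale_flat_two
    (hAU : abbesUllmo_not_dvd_maninConstant_of_not_dvd_level)
    (hf : IsNewformOf W f) (hgood : W.HasGoodReductionAtPrime 2)
    (hirr : W.HasIrreducibleModPGaloisRep 2)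
    (ha : W.frobeniusTrace 2 = 2 ∨ W.frobeniusTrace 2 = -2) (D : SignedDatum W 2)
    {Ls : IwasawaAlgebra 2} (hSP : IsSprungPair f 2 (W.frobeniusTrace 2) Ls D.L) :
    ∃ w : ℤ_[2]ˣ, (D.unitRescale w).Interpolation := by
  obtain ⟨t, ht, v, hv, hLt⟩ := interpolationUnit_flat_two_of_abbesUllmo hAU hf hgood hirr ha D hSP
  exact ⟨_, D.interpolation_unitRescale_of_unit hv ht hLt⟩

/-- (A) **p297620 on its exact binder telescope with `ha := Or.inr (a₂ = −2)`** (o1 lead D46 §2): the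
door's own term gives `BSDp W 2`, and the SAME binders `{hf, hgood, ha, hL, D, hSP, hP}` give `False`
by (iii) — its `a₂ = −2` half is vacuous AS TYPED. Diagnostic only; p297620 is not edited. [folklore] -/
theorem blindFlatDoor_bsdp_and_false_of_frobeniusTrace_eq_neg_two
    (hGZK : rank_eq_analyticRank_of_analyticRank_le_one)
    (hirr : W.HasIrreducibleModPGaloisRep 2) (hL : W.entireLFunction 1 ≠ 0) (D : SignedDatum W 2)
    (hc : ¬ 2 ∣ D.c) (hK : D.EulerCharacteristic) (hP : D.Interpolation)
    (hdiv : D.LowerDivisibility ∨ D.UpperDivisibility)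
    (hf : IsNewformOf W f) (hgood : W.HasGoodReductionAtPrime 2)
    (ha : W.frobeniusTrace 2 = -2)
    (hsign : W.rootNumber * ZMod.χ₈ (W.conductorNorm ℤ : ZMod 8) = 1) {Ls : IwasawaAlgebra 2}
    (hSP : IsSprungPair f 2 (W.frobeniusTrace 2) Ls D.L)
    {Wd : WeierstrassCurve ℚ} (htw : ∃ C : VariableChange ℚ, C • W.quadraticTwist 2 = Wd)
    (hKb : D.BlindEulerCharacteristicAt Wd 2)
    (hCb : BlindDescentCertificate Wd
      (ratPlusSymbol f ((1 : ℚ) / 8) - ratPlusSymbol f ((5 : ℚ) / 8))) : BSDp W 2 ∧ False :=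
  ⟨bsdp_two_of_oneDivisibility_of_blindControl_flat hGZK hirr hL D hc hK hP hdiv hf hgood
      (Or.inr ha) hsign hSP htw hKb hCb,
    not_interpolation_of_isSprungPair_two_of_frobeniusTrace_eq_neg_two hf hgood ha hL D hSP hP⟩

end Curve

end Package

end BlindLever

end Summit.BirchSwinnertonDyer.Rank1Residual.Supersingular

end
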